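import Mathlib
import HarnessLib
import Summits.HubbardSuperconductivity.HubbardSuperconductivity.Theorems.KLProgrammeKLRegimeEngineScaleZeroCovariance
import Summits.HubbardSuperconductivity.HubbardSuperconductivity.Theorems.KLProgrammeKLRegimeEngineFramePosKernelBound
import Literature.MathematicalPhysics.QuantumLattice.HubbardResummedCovarianceDetBound

/-!
# K3 ENGINE (stmt-HubbardSuperconductivity-20236 `KLRegimeEngineV16`), stub `stub_twoLeg_scale0`, repair (ρ2)(iii) of the GLOBAL-MOMENTUM-SIZES
# finding: the K-RESUMMED scale-`0` covariance `C̃^K_{>e₀} = normalCovariance Ψ̃` is determinant- and Gram-bounded with an ABSOLUTE constant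

Cell gate-hubbard-kl, seat hubbard-kl-k3c5-p1 g7.  In the K-resummed representation of the two-leg lane
(`…TwoLegResummedChain`: on the tube `Σ_0 − K∘p = Σ^{res}_0`, `Σ^{res}_0 = selfEnergy (effAction C̃ V_U)`, NO counterterm vertex) the
single-scale step (`GrassmannEffectiveActionBoundDB.sum_norm_kernel_effAction_le_of_gramBounded` and the W-chain) runs on the covariance
`C̃ = normalCovariance Ψ̃`, `Ψ̃ = Ψ/(1 + Ψ·K(p_k⃗)/(βL²))`, `Ψ = uvSymbolCT … K e₀`.  Its replica-stable determinant bound is the Literature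
theorem `isDetBoundedR_gridSub_resummedCovariance` (constant `√(2(7 + 2κ² + 5k_max/e₀))` for `|K(p_k⃗)| ≤ k_max ≤ e₀/4`), fed here with
k3c2-p1's absolute infrared Gram constant `κ² ≤ 1606732` of `…EngineScaleZeroCovariance` (same DOS count) and the frame's sup bound
`|K| ≤ (16/15)·Gfr0·|U|` (`abs_eval_le_of_frameOK`):

* **`isDetBoundedR_scaleZero_resummed_of_frameOK`** — for every admissible frame with `(16/15)·Gfr0·|U| ≤ e₀/4`, `klBetaMin ≤ β ≤ L`,
  `2^{15} ≤ L`, every `M ≥ 1`: `IsDetBoundedR q (Sᵀ · normalCovariance Ψ̃ · S) √(2·(7 + (2·1606732 + 5/4)))`;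
* **`isGramBoundedR_scaleZero_resummed_of_frameOK`** — the `IsGramBoundedR` form the step theorem consumes.

Everything is proved; no definitions (the resummed symbol is written out); nothing about sizes of the expansion is asserted.
-/

noncomputable section

namespace Summit.HubbardSuperconductivity.HubbardSuperconductivity.Theorems.EngineV8

set_option linter.dupNamespace false

open Real Finset Literature.MathematicalPhysics.QuantumLattice Literature.Probability.LatticeModels
open Summit.HubbardSuperconductivity.HubbardSuperconductivity.Theorems.KLRegimeSplit

/-- **The K-resummed scale-`0` covariance is determinant-bounded with an absolute constant.**  For every admissible frame
(`FrameOK R U N μ K`, `Gfr j ≥ 0`) in the regime `(16/15)·Gfr0·|U| ≤ e₀/4`, `klBetaMin ≤ β ≤ L`, `2^{15} ≤ L`, every `M ≥ 1`: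
`IsDetBoundedR q ((hubbardGridSub L M β (4M))ᵀ · normalCovariance Ψ̃ · hubbardGridSub L M β (4M)) √(2·(7 + (2·1606732 + 5/4)))`,
`Ψ̃ = Ψ/(1 + Ψ·K(p_k⃗)/(βL²))`, `Ψ = uvSymbolCT L M β μ K e₀`. -/
theorem isDetBoundedR_scaleZero_resummed_of_frameOK {R : RenConsts} {U : ℝ} {N : ℕ} {μ : ℝ} {K : TrigPolyC4v}
    (hK : FrameOK R U N μ K) (hR : ∀ j, 0 ≤ R.Gfr j) (hU : 16 / 15 * (R.Gfr 0 * |U|) ≤ klE0 / 4)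
    {β : ℝ} (hβ : klBetaMin ≤ β) {L M : ℕ} [NeZero L] [NeZero M] (hL : (2 : ℝ) ^ 15 ≤ L) (hβL : β ≤ L) :
    IsDetBoundedR (fun X : GridLeg (GridPoint L (2 * (2 * M))) => decide (X.2 = 0))
      ((hubbardGridSub L M β (2 * (2 * M))).transpose *
        normalCovariance L M (fun ks => uvSymbolCT L M β μ K klE0 ks /
          (1 + uvSymbolCT L M β μ K klE0 ks * ((K.eval (latticeMomentum L ks.1.2) / (β * (L : ℝ) ^ 2) : ℝ) : ℂ))) *
        hubbardGridSub L M β (2 * (2 * M)))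
      (Real.sqrt (2 * (7 + (2 * 1606732 + 5 / 4)))) := by
  have hβpos : 0 < β := lt_of_lt_of_le (by norm_num [klBetaMin]) hβ
  have hLpos : (0 : ℝ) < L := by exact_mod_cast Nat.pos_of_ne_zero (NeZero.ne L)
  have he₀ : (0 : ℝ) < klE0 := by norm_num [klE0]
  have hπβ : Real.pi / β ≤ klE0 := by
    rw [div_le_iff₀ hβpos, klE0]
    have h128 : (128 : ℝ) ≤ β := by simpa [klBetaMin] using hβ
    nlinarith [Real.pi_lt_four]
  -- the DOS count of the frame band and the infrared Gram constant (k3c2-p1, verbatim)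
  have hcount : ∀ η : ℝ, 0 < η → η ≤ klE0 →
      (((univ.filter fun k : TorusSite 2 L => |nambuXiCT L μ K k| < η).card : ℕ) : ℝ) ≤ 2200 * η * (L : ℝ) ^ 2 + 200000 * L := by
    intro η hη hηe
    exact card_filter_nambuXiCT_lt_le_of_frameOK hK L hL hη.le (by simpa [klE0] using hηe)
  have hsum := sum_one_sub_hubbardCutoffWeightCT_div_sqrt_le (M := M) hβpos μ K he₀ hπβ hβL (by norm_num : (0 : ℝ) ≤ 2200)
    (by norm_num : (0 : ℝ) ≤ 200000) hcount
  have hκ : 1 / (β * (L : ℝ) ^ 2) * ∑ k : FreqMomentum L M,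
      (1 - hubbardCutoffWeightCT L M β μ K klE0 k) / Real.sqrt (matsubaraFreq β M k.1 ^ 2 + nambuXiCT L μ K k.2 ^ 2) ≤
        (Real.sqrt 1606732) ^ 2 := by
    rw [Real.sq_sqrt (by norm_num)]
    have hβL2 : 0 < β * (L : ℝ) ^ 2 := by positivity
    rw [one_div, inv_mul_le_iff₀ hβL2]
    refine hsum.trans ?_
    rw [klE0]
    nlinarith
  -- the frame is small against the scale
  have hKmax : ∀ kv : TorusSite 2 L, |K.eval (latticeMomentum L kv)| ≤ klE0 / 4 := fun kv =>
    (abs_eval_le_of_frameOK hK hR _).trans hU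
  have h := isDetBoundedR_gridSub_resummedCovariance (L := L) (M := M) hβpos μ K he₀ hKmax le_rfl hκ
  have hconst : 2 * (Real.sqrt 1606732) ^ 2 + 5 * (klE0 / 4) / klE0 = 2 * 1606732 + 5 / 4 := by
    rw [Real.sq_sqrt (by norm_num), klE0]
    norm_num
  rwa [hconst] at h

/-- The pulled-back resummed covariance is CHARGED for `q X = [X.2 = 0]` (it is normal). -/
theorem gridSub_resummedCovariance_apply_of_charge_eq (β μ : ℝ) (K : TrigPolyC4v) (Λ : ℝ) {L M : ℕ} [NeZero L] (N : ℕ)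
    {X Y : GridLeg (GridPoint L N)}
    (h : (fun Z : GridLeg (GridPoint L N) => decide (Z.2 = 0)) X = (fun Z : GridLeg (GridPoint L N) => decide (Z.2 = 0)) Y) :
    ((hubbardGridSub L M β N).transpose *
        normalCovariance L M (fun ks => uvSymbolCT L M β μ K Λ ks /
          (1 + uvSymbolCT L M β μ K Λ ks * ((K.eval (latticeMomentum L ks.1.2) / (β * (L : ℝ) ^ 2) : ℝ) : ℂ))) *
        hubbardGridSub L M β N) X Y = 0 := by
  have hXY : X.2 = Y.2 := by
    have h' : decide (X.2 = 0) = decide (Y.2 = 0) := h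
    rcases Fin.eq_zero_or_eq_succ X.2 with hx | ⟨i, hx⟩ <;> rcases Fin.eq_zero_or_eq_succ Y.2 with hy | ⟨j, hy⟩
    · rw [hx, hy]
    · exfalso; rw [hx, hy] at h'; simp [Fin.succ_ne_zero] at h'
    · exfalso; rw [hx, hy] at h'; simp [Fin.succ_ne_zero] at h'
    · rw [hx, hy, Fin.eq_zero i, Fin.eq_zero j]
  rw [hubbardGridSub]
  exact gridSub_pullback_normalCovariance_apply_of_charge_eq β _ _ _ hXY

/-- **The K-resummed scale-`0` covariance is replica-Gram-bounded with an absolute constant** — the literal covariance hypothesis of the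
single-scale step for `effAction C̃^K_{>e₀} V_U` on the `4M` grid (the K-resummed representation: no counterterm vertex). -/
theorem isGramBoundedR_scaleZero_resummed_of_frameOK {R : RenConsts} {U : ℝ} {N : ℕ} {μ : ℝ} {K : TrigPolyC4v}
    (hK : FrameOK R U N μ K) (hR : ∀ j, 0 ≤ R.Gfr j) (hU : 16 / 15 * (R.Gfr 0 * |U|) ≤ klE0 / 4)
    {β : ℝ} (hβ : klBetaMin ≤ β) {L M : ℕ} [NeZero L] [NeZero M] (hL : (2 : ℝ) ^ 15 ≤ L) (hβL : β ≤ L) :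
    IsGramBoundedR
      ((hubbardGridSub L M β (2 * (2 * M))).transpose *
        normalCovariance L M (fun ks => uvSymbolCT L M β μ K klE0 ks /
          (1 + uvSymbolCT L M β μ K klE0 ks * ((K.eval (latticeMomentum L ks.1.2) / (β * (L : ℝ) ^ 2) : ℝ) : ℂ))) *
        hubbardGridSub L M β (2 * (2 * M)))
      (Real.sqrt (2 * (7 + (2 * 1606732 + 5 / 4)))) :=
  (isDetBoundedR_scaleZero_resummed_of_frameOK hK hR hU hβ hL hβL).isGramBoundedR
    (fun _ _ h => gridSub_resummedCovariance_apply_of_charge_eq β μ K klE0 (2 * (2 * M)) h) (Real.sqrt_nonneg _)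

end Summit.HubbardSuperconductivity.HubbardSuperconductivity.Theorems.EngineV8

end
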